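import Literature.AlgebraicGeometry.ModuliOfAbelianVarieties.SiegelFamilyEllipticSquareHumbert
import HarnessLib

/-!
# `E_τ × E_τ` with complex multiplication (`τ² = sτ + t`) on the diagonal of the Siegel family: `End(E_τ) ≅ ℤ²`
# with degree form `u² − suv − tv²`, Kani's ternary form `f_q = z² + 4q(x, y)` cutting out the Humbert surfaces
# through `E_τ × E_τ`, elliptic curves by degree, principal polarisations `xy − q(z, w) = 1`; the squares `E_i²`, `E_ω²`

Layer `Literature/AlgebraicGeometry/ModuliOfAbelianVarieties`, namespace
`Literature.AlgebraicGeometry.ModuliOfAbelianVarieties.SiegelModuli`; lane `lit-hodgefound` (Track 2 foundations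
library, Layer A4), seat `lit-hodgefound-skel-4`, row **A4-63 FILE 4**. Sequel of FILE 3
(`SiegelFamilyEllipticSquareHumbert`: the square `E × E` at `Z = diag(τ, τ)`, `mem_homInt_iff_of_diag`:
`A ∈ End(E_τ) ⟺ A₀₁τ² + (A₁₁ − A₀₀)τ − A₁₀ = 0`, and the case `End(E_τ) = ℤ` of NO complex multiplication), now
the complementary case of COMPLEX MULTIPLICATION by the quadratic order `ℤ[τ]`, `τ² = sτ + t` (`s, t ∈ ℤ`,
`s² + 4t < 0`; e.g. `τ = i, ω, √−n, (1 + √−d)/2`): Kani's rank `r = rank Hom(E₁, E₂) = 2`, where the degree form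
`q_{E,E}` is a positive binary quadratic form and the Humbert / principal-polarisation conditions of FILE 1/2
become Kani's ternary `f_q(x, y, z) = z² + 4q(x, y)` and quaternary `Q(x, y, z, w) = xy − q(z, w)` (Thm. 13).

## Sources followed, verbatim

* E. Kani, *Jacobians isomorphic to a product of two elliptic curves and ternary quadratic forms*, J. Number Theory
  139 (2014) (held `paper:doi-10-1016-j-jnt-2013-12-006`): §1 (p0001) "`q_{E₁,E₂}(f) := deg(f)` for
  `f ∈ Hom(E₁, E₂)`. Note that by fixing a basis of `Hom(E₁, E₂)` we obtain an explicit binary quadratic form";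
  §2 (5)–(6) (p0005) "`q_{E₁×E₂}(x, y, f) = xy − q_{E₁,E₂}(f)`", "`r = rank(Hom(E₁, E₂))`"; §3 Thm. 13 (p0008)
  "Let `q(x, y) = ax² + bxy + cy²` be a positive definite binary quadratic form, and let
  `f_q(x, y, z) = z² + 4q(x, y)` and `Q(x, y, z, w) = xy − q(z, w)`", proof of Cor. 14 "If `E₁` has CM, i.e. if
  `r = rank(Hom(E₁, E₂)) = 2`".
* J. H. Silverman, *The Arithmetic of Elliptic Curves*, Ch. VI Thm. 5.5: `End(E_τ) ≅ {α ∈ ℂ : αΛ ⊆ Λ}`, (ii) an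
  order in the imaginary quadratic field `ℚ(τ)` in the CM case.
* C. Birkenhake, H. Wilhelm, *Humbert surfaces and the Kummer plane*, Trans. AMS 355 (2003), §1 (∗)
  (`Δ = b² − 4ac − 4de`), §4 Prop. 4.8 (`H_{δ²}` ↔ elliptic curves of degree `δ`).

## Contents (theorems only; no definition, no named fact)

For `Z ∈ 𝔥₂` with `z₁₂ = 0`, `z₁₁ = z₂₂ = τ` and `τ² = sτ + t` (`s t : ℤ`); `M(u, v) := (u, v; tv, u − sv)`:
* §A `det_cmEnd` (`det M(u, v) = u² − suv − tv²`), **`mem_homInt_iff_of_diag_of_sq_eq`** /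
  **`mem_homInt_iff_exists_cmEnd`** (`End(E_τ) = {M(u, v)} ≅ ℤ²`, `r = 2`), `cmEnd_primitive_iff`,
  `primitive₃_iff_gcd_eq_one`, **`mem_humbertLocusOfInvariant_iff_of_diag_of_sq_eq`** (`E_τ × E_τ ∈ H_Δ ⟺
  Δ = b² + 4(u² − suv − tv²)`, `(b, u, v) ≠ 0` — `f_q` represents `Δ`),
  **`exists_ellipticCurve_degree_eq_iff_of_diag_of_sq_eq`** (an elliptic curve of degree `δ` ⟺
  `δ² = b² + 4(u² − suv − tv²)` with `gcd(b, u, v) = 1` — `f_q` primitively represents `δ²`),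
  **`isPrincipalPolarization_iff_of_diag_of_sq_eq`** (principal polarisations: `a > 0`, `ab − q(u, v) = 1`).
* §B the Gaussian square `τ² = −1` (`q = u² + v²`): `mem_humbertLocusOfInvariant_iff_of_gaussian`
  (`E_i × E_i ∈ H_Δ ⟺ Δ = b² + 4u² + 4v²`), **`exists_ellipticCurve_degree_three_of_gaussian`** (an elliptic curve
  of degree `3` on `E_i × E_i`: `9 = 1 + 4(1 + 1)` — none exists on `E × E` without CM, FILE 3),
  `mem_humbertLocusOfInvariant_eight_and_twelve_of_gaussian` (`E_i × E_i ∈ H_8 ∩ H_{12}`).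
* §C the Eisenstein square `ω² = −ω − 1` (`q = u² + uv + v²`): `mem_humbertLocusOfInvariant_iff_of_eisenstein`,
  **`not_exists_ellipticCurve_degree_three_of_eisenstein`** (NO elliptic curve of degree `3` on `E_ω × E_ω`:
  `2` is not a norm from `ℤ[ω]`).

Not here: non-maximal / non-monogenic presentations `aτ² + bτ + c = 0` with `a > 1` (replace `τ` by an
`Sl₂(ℤ)`-equivalent point or use `End = ℤ[aτ]`; the tree's `ComplexTorusEllipticCurveEndomorphismRing` has the
general order), Kani's Thm. 13 equivalences (i)–(v) themselves (idoneal-valued forms), the count of curves.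

## References

* [Kani2014JacobiansTernaryForms] E. Kani, J. Number Theory 139 (2014) 138–174, §1, §2 (5)–(6), §3 Thm. 13, Cor. 14.
* [KaniCurvesGenus2AbelianSurfaces] E. Kani, *Curves of genus 2 on abelian surfaces*, preprint, §7 (52).
* [Kani1994EllipticCurvesAbelianSurfaces] E. Kani, Manuscripta Math. 84 (1994) 199–223.
* [SilvermanAEC2009] J. H. Silverman, *The Arithmetic of Elliptic Curves*, Ch. VI Thm. 5.5.
* [BirkenhakeWilhelm2003] C. Birkenhake, H. Wilhelm, Trans. Amer. Math. Soc. 355 (2003), §1 (∗), §4 Prop. 4.8.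
-/

noncomputable section

open scoped ComplexOrder
open Module Function Complex Matrix Set Sum

namespace Literature.AlgebraicGeometry.ModuliOfAbelianVarieties

namespace SiegelModuli

open Literature.NumberTheory.Automorphic (siegelUpperHalfSpace)
open Literature.NumberTheory.ModularForms.SiegelUpperHalfSpace
open Literature.Geometry.Kaehler Literature.Geometry.Kaehler.ComplexTorus
open Literature.Analysis.Complex Literature.LinearAlgebra.Alternating

/-! ## §A `End(E_τ)` for a quadratic integer `τ` (`τ² = sτ + t`): `Hom = {M(u, v)} ≅ ℤ²`, `deg M(u, v) = u² − suv − tv²` -/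

section CMSquare

variable (Z : siegelUpperHalfSpace 2) (hd : (Z : Matrix (Fin 2) (Fin 2) ℂ) 0 1 = 0)
  (hdiag : (Z : Matrix (Fin 2) (Fin 2) ℂ) 0 0 = (Z : Matrix (Fin 2) (Fin 2) ℂ) 1 1) {s t : ℤ}
  (hτ : ((Z : Matrix (Fin 2) (Fin 2) ℂ) 0 0) ^ 2 = s * (Z : Matrix (Fin 2) (Fin 2) ℂ) 0 0 + t)

/-- **The degree form of `ℤ[τ]`, `τ² = sτ + t`: `det M(u, v) = u² − suv − tv²`** for
`M(u, v) = (u, v; tv, u − sv)` (the rational representation of the endomorphism `z ↦ (u + v(τ − s))z = (u − vτ̄)z`,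
of degree `N(u − vτ̄) = u² − suv − tv²`) — Kani's binary form `q_{E,E}(f) = deg f`, here the principal form of
discriminant `s² + 4t < 0`.
[cite: Kani2014JacobiansTernaryForms, §1 (p. 1: "`q_{E₁,E₂}(f) := deg(f)` … an explicit binary quadratic form") and §3 Thm. 13 (`q(x, y) = ax² + bxy + cy²`)] -/
theorem det_cmEnd (u v : ℤ) : (!![u, v; t * v, u - s * v] : Matrix (Fin 2) (Fin 2) ℤ).det = u ^ 2 - s * u * v - t * v ^ 2 := by
  rw [Matrix.det_fin_two_of]
  ring

include hdiag hτ in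
/-- **`End(E_τ)` FOR A QUADRATIC INTEGER `τ`, `τ² = sτ + t`** (complex multiplication by `ℤ[τ]`): an integer matrix
`A` is an endomorphism of `E_τ` iff `A₁₁ = A₀₀ − sA₀₁` and `A₁₀ = tA₀₁` (from `A₀₁τ² + (A₁₁ − A₀₀)τ − A₁₀ = 0` and
`1, τ` independent over `ℝ`). [cite: SilvermanAEC2009, Ch. VI Thm. 5.5 (ii)] [cite: Kani2014JacobiansTernaryForms, §3 proof of Cor. 14 ("if `E₁` has CM, i.e. if `r = rank(Hom(E₁, E₂)) = 2`")] -/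
theorem mem_homInt_iff_of_diag_of_sq_eq (A : Matrix (Fin 2) (Fin 2) ℤ) :
    A ∈ homInt (fstPeriod Z) (sndPeriod Z) ↔ A 1 1 = A 0 0 - s * A 0 1 ∧ A 1 0 = t * A 0 1 := by
  rw [mem_homInt_iff_of_diag Z hdiag, hτ]
  set τ := (Z : Matrix (Fin 2) (Fin 2) ℂ) 0 0 with hτdef
  have hτim : τ.im ≠ 0 := (im_apply_zero_zero_pos Z).ne'
  constructor
  · intro h
    have h' : ((A 0 1 * s + A 1 1 - A 0 0 : ℤ) : ℂ) * τ + ((A 0 1 * t - A 1 0 : ℤ) : ℂ) = 0 := by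
      push_cast
      linear_combination h
    have him := congrArg Complex.im h'
    simp only [add_im, mul_im, intCast_re, intCast_im, zero_mul, add_zero, zero_im] at him
    have h1 : ((A 0 1 * s + A 1 1 - A 0 0 : ℤ) : ℝ) = 0 := by
      rcases mul_eq_zero.1 him with h | h
      · exact h
      · exact absurd h hτim
    have h1' : A 0 1 * s + A 1 1 - A 0 0 = 0 := by exact_mod_cast h1
    have h1c : ((A 0 1 * s + A 1 1 - A 0 0 : ℤ) : ℂ) = 0 := by exact_mod_cast h1'
    rw [h1c, zero_mul, zero_add] at h'
    have h2 : A 0 1 * t - A 1 0 = 0 := by exact_mod_cast h'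
    constructor <;> linarith
  · rintro ⟨h11, h10⟩
    rw [h11, h10]
    push_cast
    ring

include hdiag hτ in
/-- **`Hom(E_τ, E_τ) = {M(u, v) : u, v ∈ ℤ} ≅ ℤ²`** for `τ² = sτ + t`: rank `r = 2` (Kani: "`E₁` has CM, i.e.
`r = rank(Hom(E₁, E₂)) = 2`"). [cite: Kani2014JacobiansTernaryForms, §3 proof of Cor. 14 (p. 8)] [cite: SilvermanAEC2009, Ch. VI Thm. 5.5 (ii)] -/
theorem mem_homInt_iff_exists_cmEnd (A : Matrix (Fin 2) (Fin 2) ℤ) :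
    A ∈ homInt (fstPeriod Z) (sndPeriod Z) ↔ ∃ u v : ℤ, A = !![u, v; t * v, u - s * v] := by
  rw [mem_homInt_iff_of_diag_of_sq_eq Z hdiag hτ]
  constructor
  · rintro ⟨h11, h10⟩
    refine ⟨A 0 0, A 0 1, ?_⟩
    ext i j
    fin_cases i <;> fin_cases j <;> simp [h11, h10]
  · rintro ⟨u, v, rfl⟩
    simp

/-- Primitivity of `(b, M(u, v))` in `ℤ × Hom` is primitivity of the integer vector `(b, u, v)`. [cite: Kani2014JacobiansTernaryForms, §3 (primitive representations `f → n`, p. 6)] -/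
theorem cmEnd_primitive_iff (b u v : ℤ) :
    (∀ (k : ℤ) (b' : ℤ) (A' : Matrix (Fin 2) (Fin 2) ℤ), b = k * b' →
        (!![u, v; t * v, u - s * v] : Matrix (Fin 2) (Fin 2) ℤ) = k • A' → k = 1 ∨ k = -1) ↔
      ∀ k b' u' v' : ℤ, b = k * b' → u = k * u' → v = k * v' → k = 1 ∨ k = -1 := by
  constructor
  · intro h k b' u' v' hb hu hv
    refine h k b' !![u', v'; t * v', u' - s * v'] hb ?_
    ext i j
    fin_cases i <;> fin_cases j <;> simp [hu, hv] <;> ring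
  · intro h k b' A' hb hA
    refine h k b' (A' 0 0) (A' 0 1) hb ?_ ?_
    · have := congrFun (congrFun hA 0) 0
      simpa using this
    · have := congrFun (congrFun hA 0) 1
      simpa using this

/-- The primitivity of `(b, u, v)` is `gcd(b, u, v) = 1`. [cite: Kani2014JacobiansTernaryForms, §3 (p. 6, primitive representations)] -/
theorem primitive₃_iff_gcd_eq_one (b u v : ℤ) :
    (∀ k b' u' v' : ℤ, b = k * b' → u = k * u' → v = k * v' → k = 1 ∨ k = -1) ↔ Int.gcd (Int.gcd b u) v = 1 := by
  constructor
  · intro h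
    set g : ℤ := ((Int.gcd (Int.gcd b u) v : ℕ) : ℤ) with hg
    have hgb : g ∣ b := (Int.gcd_dvd_left _ v).trans (Int.gcd_dvd_left b u)
    have hgu : g ∣ u := (Int.gcd_dvd_left _ v).trans (Int.gcd_dvd_right b u)
    have hgv : g ∣ v := Int.gcd_dvd_right _ v
    obtain ⟨b', hb'⟩ := hgb
    obtain ⟨u', hu'⟩ := hgu
    obtain ⟨v', hv'⟩ := hgv
    have hk := h g b' u' v' hb' hu' hv'
    have hg0 : (0 : ℤ) ≤ g := by positivity
    rcases hk with hk | hk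
    · rw [hg] at hk
      exact_mod_cast hk
    · omega
  · intro h k b' u' v' hb hu hv
    have hkb : k ∣ b := ⟨b', hb⟩
    have hku : k ∣ u := ⟨u', hu⟩
    have hkv : k ∣ v := ⟨v', hv⟩
    have h1 : k ∣ (Int.gcd b u : ℤ) := Int.dvd_coe_gcd hkb hku
    have h2 : k ∣ (Int.gcd (Int.gcd b u) v : ℤ) := Int.dvd_coe_gcd h1 hkv
    rw [h, Nat.cast_one] at h2
    exact Int.isUnit_iff.1 (isUnit_of_dvd_one h2)

include hd hdiag hτ in
/-- **THE HUMBERT SURFACES THROUGH `E_τ × E_τ` WITH COMPLEX MULTIPLICATION `τ² = sτ + t`: `E_τ × E_τ ∈ H_Δ ⟺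
Δ = b² + 4(u² − suv − tv²)` for some `(b, u, v) ≠ 0`** — Kani's ternary form `f_q(x, y, z) = z² + 4q(x, y)`
attached to the binary degree form `q = q_{E,E}` (Thm. 13), through FILE 1's
`mem_humbertLocusOfInvariant_iff_exists_homInt`. [cite: Kani2014JacobiansTernaryForms, §3 Thm. 13 ("`f_q(x, y, z) = z² + 4q(x, y)`") with §2 (5)–(6)] [cite: BirkenhakeWilhelm2003, §1 (∗)] -/
theorem mem_humbertLocusOfInvariant_iff_of_diag_of_sq_eq {Δ : ℤ} :
    Z ∈ humbertLocusOfInvariant Δ ↔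
      ∃ b u v : ℤ, (b ≠ 0 ∨ u ≠ 0 ∨ v ≠ 0) ∧ Δ = b ^ 2 + 4 * (u ^ 2 - s * u * v - t * v ^ 2) := by
  rw [mem_humbertLocusOfInvariant_iff_exists_homInt Z hd]
  constructor
  · rintro ⟨b, A, hne, hA, hΔ⟩
    obtain ⟨u, v, rfl⟩ := (mem_homInt_iff_exists_cmEnd Z hdiag hτ A).1 hA
    refine ⟨b, u, v, ?_, by rw [← hΔ, det_cmEnd]⟩
    rcases hne with hb | hA0
    · exact Or.inl hb
    · by_contra hc
      simp only [not_or, not_not] at hc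
      obtain ⟨-, rfl, rfl⟩ := hc
      exact hA0 (by ext i j; fin_cases i <;> fin_cases j <;> simp)
  · rintro ⟨b, u, v, hne, hΔ⟩
    refine ⟨b, !![u, v; t * v, u - s * v], ?_, (mem_homInt_iff_exists_cmEnd Z hdiag hτ _).2 ⟨u, v, rfl⟩,
      by rw [hΔ, det_cmEnd]⟩
    rcases hne with hb | hu | hv
    · exact Or.inl hb
    · right
      intro h0
      exact hu (by simpa using congrFun (congrFun h0 0) 0)
    · right
      intro h0
      exact hv (by simpa using congrFun (congrFun h0 0) 1)

include hd hdiag hτ in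
/-- **ELLIPTIC CURVES ON `E_τ × E_τ` WITH CM `τ² = sτ + t`, BY DEGREE: an elliptic curve of degree `δ > 0` exists
iff `δ² = b² + 4(u² − suv − tv²)` with `gcd(b, u, v) = 1`** (`f_q` PRIMITIVELY represents `δ²`).
[cite: Kani1994EllipticCurvesAbelianSurfaces] [cite: Kani2014JacobiansTernaryForms, §3 Thm. 13 (`f_q = z² + 4q(x, y)`), §2 (5)–(6)] [cite: BirkenhakeWilhelm2003, §4 Prop. 4.8] -/
theorem exists_ellipticCurve_degree_eq_iff_of_diag_of_sq_eq {δ : ℤ} (hδ : 0 < δ) :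
    (∃ Y : SubtorusFrame (prinPeriod Z) 2,
        (δ : ℝ) = -prinForm Z ![latticeVec (prinPeriod Z) (Y.frame 0), latticeVec (prinPeriod Z) (Y.frame 1)]) ↔
      ∃ b u v : ℤ, Int.gcd (Int.gcd b u) v = 1 ∧ δ ^ 2 = b ^ 2 + 4 * (u ^ 2 - s * u * v - t * v ^ 2) := by
  rw [exists_ellipticCurve_degree_eq_iff_exists_homInt Z hd hδ]
  constructor
  · rintro ⟨b, A, hprim, hA, hΔ⟩
    obtain ⟨u, v, rfl⟩ := (mem_homInt_iff_exists_cmEnd Z hdiag hτ A).1 hA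
    exact ⟨b, u, v, (primitive₃_iff_gcd_eq_one b u v).1 ((cmEnd_primitive_iff b u v).1 hprim),
      by rw [← hΔ, det_cmEnd]⟩
  · rintro ⟨b, u, v, hg, hΔ⟩
    exact ⟨b, !![u, v; t * v, u - s * v], (cmEnd_primitive_iff b u v).2 ((primitive₃_iff_gcd_eq_one b u v).2 hg),
      (mem_homInt_iff_exists_cmEnd Z hdiag hτ _).2 ⟨u, v, rfl⟩, by rw [hΔ, det_cmEnd]⟩

include hd hdiag hτ in
/-- **The principal polarisations of `E_τ × E_τ` with CM `τ² = sτ + t`**: the classes `D(a, b, M(u, v))` with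
`a > 0` and `ab − (u² − suv − tv²) = 1` — Kani's quaternary form `Q(x, y, z, w) = xy − q(z, w)` representing `1`
(Thm. 13: "`Q(x, y, z, w) = xy − q(z, w)`", `P(Q)`). [cite: Kani2014JacobiansTernaryForms, §3 Thm. 13 and §2 Prop. 7 ("`θ ∈ NS(A)` with `q_A(θ) = 1`")] [cite: KaniCurvesGenus2AbelianSurfaces, §7 (52)] -/
theorem isPrincipalPolarization_iff_of_diag_of_sq_eq (η : neronSeveriGroup (prinPeriod Z)) :
    IsPrincipalPolarization (prinPeriod Z) (η : (Fin 2 → ℂ) [⋀^Fin 2]→L[ℝ] ℝ) ↔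
      ∃ u v : ℤ, ((neronSeveriProdEquiv Z hd η).2.2 : Matrix (Fin 2) (Fin 2) ℤ) = !![u, v; t * v, u - s * v] ∧
        0 < (neronSeveriProdEquiv Z hd η).1 ∧
          (neronSeveriProdEquiv Z hd η).1 * (neronSeveriProdEquiv Z hd η).2.1 - (u ^ 2 - s * u * v - t * v ^ 2) = 1 := by
  rw [isPrincipalPolarization_iff_coordinates Z hd η]
  obtain ⟨u, v, huv⟩ := (mem_homInt_iff_exists_cmEnd Z hdiag hτ _).1 (neronSeveriProdEquiv Z hd η).2.2.2
  constructor
  · rintro ⟨h1, h2⟩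
    exact ⟨u, v, huv, h1, by rw [huv, det_cmEnd] at h2; exact h2⟩
  · rintro ⟨u', v', huv', h1, h2⟩
    refine ⟨h1, ?_⟩
    rw [huv', det_cmEnd]
    exact h2

/-! ## §B The Gaussian square `E_i × E_i` (`τ² = −1`): `q = u² + v²`, an elliptic curve of degree `3` -/

include hd hdiag in
/-- **`E_i × E_i` lies on `H_Δ` iff `Δ = b² + 4u² + 4v²` for some `(b, u, v) ≠ 0`** (`τ² = −1`: `s = 0`,
`t = −1`, `q_{E,E} = u² + v²`, Kani's `f_q = z² + 4x² + 4y²`; e.g. `H_1, H_4, H_5, H_8, H_9, H_12, H_13, …`).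
[cite: Kani2014JacobiansTernaryForms, §3 Thm. 13 (the form `(1, 0, 1)` of the list `L`)] [cite: BirkenhakeWilhelm2003, §1 (∗)] -/
theorem mem_humbertLocusOfInvariant_iff_of_gaussian (hi : ((Z : Matrix (Fin 2) (Fin 2) ℂ) 0 0) ^ 2 = -1) {Δ : ℤ} :
    Z ∈ humbertLocusOfInvariant Δ ↔ ∃ b u v : ℤ, (b ≠ 0 ∨ u ≠ 0 ∨ v ≠ 0) ∧ Δ = b ^ 2 + 4 * u ^ 2 + 4 * v ^ 2 := by
  have hτ' : ((Z : Matrix (Fin 2) (Fin 2) ℂ) 0 0) ^ 2 = ((0 : ℤ) : ℂ) * (Z : Matrix (Fin 2) (Fin 2) ℂ) 0 0 + ((-1 : ℤ) : ℂ) := by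
    rw [hi]; push_cast; ring
  rw [mem_humbertLocusOfInvariant_iff_of_diag_of_sq_eq Z hd hdiag hτ']
  refine exists_congr fun b ↦ exists_congr fun u ↦ exists_congr fun v ↦ and_congr Iff.rfl ?_
  constructor <;> intro h <;> linear_combination h

include hd hdiag in
/-- **`E_i × E_i` CONTAINS AN ELLIPTIC CURVE OF DEGREE `3`** (`9 = 1² + 4(1² + 1²)`, `gcd(1, 1, 1) = 1`: the
relation `(b, f) = (1, 1 + i)`, `deg(1 + i) = 2`) — in contrast with `E × E` for `E` WITHOUT complex
multiplication, which has none (FILE 3 `not_exists_ellipticCurve_degree_three_of_diag_of_not_quadratic`).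
[cite: Kani1994EllipticCurvesAbelianSurfaces] [cite: Kani2014JacobiansTernaryForms, §3 Thm. 13 (`f_q` for `q = (1, 0, 1)`)] [cite: BirkenhakeWilhelm2003, §4 Prop. 4.8 (`H_9`)] -/
theorem exists_ellipticCurve_degree_three_of_gaussian (hi : ((Z : Matrix (Fin 2) (Fin 2) ℂ) 0 0) ^ 2 = -1) :
    ∃ Y : SubtorusFrame (prinPeriod Z) 2,
      ((3 : ℤ) : ℝ) = -prinForm Z ![latticeVec (prinPeriod Z) (Y.frame 0), latticeVec (prinPeriod Z) (Y.frame 1)] := by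
  have hτ' : ((Z : Matrix (Fin 2) (Fin 2) ℂ) 0 0) ^ 2 = ((0 : ℤ) : ℂ) * (Z : Matrix (Fin 2) (Fin 2) ℂ) 0 0 + ((-1 : ℤ) : ℂ) := by
    rw [hi]; push_cast; ring
  rw [exists_ellipticCurve_degree_eq_iff_of_diag_of_sq_eq Z hd hdiag hτ' (by norm_num)]
  exact ⟨1, 1, 1, by decide, by norm_num⟩

include hd hdiag in
/-- `E_i × E_i` lies on `H_8` (`8 = 0² + 4(1² + 1²)`: the relation `(0, 1 + i)`, `deg(1 + i) = 2` — real
multiplication by `ℤ[√2]`, `ρ = (0, (1+i)^∨; 1+i, 0)`, `ρ² = 2`) and on `H_{12}` (`12 = 2² + 4(1² + 1²)`); `12` is NOT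
of the form `b² + 4m²`, so `H_{12}` contains no `E × E` with `E` without complex multiplication (FILE 3
`mem_humbertLocusOfInvariant_iff_of_diag_of_not_quadratic`), while `8 = 2² + 4·1²` is.
[cite: Kani2014JacobiansTernaryForms, §3 Thm. 13] [cite: BirkenhakeWilhelm2003, §1 (∗)] -/
theorem mem_humbertLocusOfInvariant_eight_and_twelve_of_gaussian (hi : ((Z : Matrix (Fin 2) (Fin 2) ℂ) 0 0) ^ 2 = -1) :
    Z ∈ humbertLocusOfInvariant 8 ∧ Z ∈ humbertLocusOfInvariant 12 :=
  ⟨(mem_humbertLocusOfInvariant_iff_of_gaussian Z hd hdiag hi).2 ⟨0, 1, 1, Or.inr (Or.inl one_ne_zero), by norm_num⟩,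
    (mem_humbertLocusOfInvariant_iff_of_gaussian Z hd hdiag hi).2 ⟨2, 1, 1, Or.inl two_ne_zero, by norm_num⟩⟩

/-! ## §C The Eisenstein square `E_ω × E_ω` (`ω² = −ω − 1`): `q = u² + uv + v²`, NO elliptic curve of degree `3` -/

include hd hdiag in
/-- **`E_ω × E_ω` lies on `H_Δ` iff `Δ = b² + 4(u² + uv + v²)` for some `(b, u, v) ≠ 0`** (`ω² + ω + 1 = 0`:
`s = t = −1`, `q_{E,E} = u² + uv + v²` the norm form of `ℤ[ω]`, Kani's form `(1, 1, 1)` of the list `L`).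
[cite: Kani2014JacobiansTernaryForms, §3 Thm. 13 (the form `(1, 1, 1)`)] [cite: BirkenhakeWilhelm2003, §1 (∗)] -/
theorem mem_humbertLocusOfInvariant_iff_of_eisenstein
    (hω : ((Z : Matrix (Fin 2) (Fin 2) ℂ) 0 0) ^ 2 = -(Z : Matrix (Fin 2) (Fin 2) ℂ) 0 0 - 1) {Δ : ℤ} :
    Z ∈ humbertLocusOfInvariant Δ ↔
      ∃ b u v : ℤ, (b ≠ 0 ∨ u ≠ 0 ∨ v ≠ 0) ∧ Δ = b ^ 2 + 4 * (u ^ 2 + u * v + v ^ 2) := by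
  have hτ' : ((Z : Matrix (Fin 2) (Fin 2) ℂ) 0 0) ^ 2 =
      ((-1 : ℤ) : ℂ) * (Z : Matrix (Fin 2) (Fin 2) ℂ) 0 0 + ((-1 : ℤ) : ℂ) := by
    rw [hω]; push_cast; ring
  rw [mem_humbertLocusOfInvariant_iff_of_diag_of_sq_eq Z hd hdiag hτ']
  refine exists_congr fun b ↦ exists_congr fun u ↦ exists_congr fun v ↦ and_congr Iff.rfl ?_
  constructor <;> intro h <;> linear_combination h

include hd hdiag in
/-- **`E_ω × E_ω` CONTAINS NO ELLIPTIC CURVE OF DEGREE `3`** — although it has complex multiplication: `9 = b² +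
4(u² + uv + v²)` with `gcd(b, u, v) = 1` is impossible (`b = ±1` needs `u² + uv + v² = 2`, not a norm from
`ℤ[ω]`; `b = ±3` needs `(u, v) = 0`). Compare `E_i × E_i` (§B: a curve of degree `3`) and `E × E` without CM
(FILE 3: none). [cite: Kani1994EllipticCurvesAbelianSurfaces] [cite: Kani2014JacobiansTernaryForms, §3 Thm. 13 (`f_q` for `q = (1, 1, 1)`)] [cite: BirkenhakeWilhelm2003, §4 Prop. 4.8] -/
theorem not_exists_ellipticCurve_degree_three_of_eisenstein
    (hω : ((Z : Matrix (Fin 2) (Fin 2) ℂ) 0 0) ^ 2 = -(Z : Matrix (Fin 2) (Fin 2) ℂ) 0 0 - 1) :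
    ¬ ∃ Y : SubtorusFrame (prinPeriod Z) 2,
        ((3 : ℤ) : ℝ) = -prinForm Z ![latticeVec (prinPeriod Z) (Y.frame 0), latticeVec (prinPeriod Z) (Y.frame 1)] := by
  have hτ' : ((Z : Matrix (Fin 2) (Fin 2) ℂ) 0 0) ^ 2 =
      ((-1 : ℤ) : ℂ) * (Z : Matrix (Fin 2) (Fin 2) ℂ) 0 0 + ((-1 : ℤ) : ℂ) := by
    rw [hω]; push_cast; ring
  rw [exists_ellipticCurve_degree_eq_iff_of_diag_of_sq_eq Z hd hdiag hτ' (by norm_num)]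
  rintro ⟨b, u, v, hg, h0⟩
  -- `4(u² + uv + v²) = (2u + v)² + 3v² ≥ 0`, so `b² ≤ 9`; `b` is odd; `q = 2` and (`q = 0`, `b = ±3`) are excluded
  have h : 9 = b ^ 2 + 4 * (u ^ 2 + u * v + v ^ 2) := by linear_combination h0
  clear h0
  have hq : 0 ≤ u ^ 2 + u * v + v ^ 2 := by nlinarith [sq_nonneg (2 * u + v), sq_nonneg v]
  have hb : -3 ≤ b ∧ b ≤ 3 := by constructor <;> nlinarith
  obtain ⟨hb1, hb2⟩ := hb
  have hq2 : u ^ 2 + u * v + v ^ 2 ≠ 2 := by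
    intro h2
    have hv : -1 ≤ v ∧ v ≤ 1 := by constructor <;> nlinarith [sq_nonneg (2 * u + v)]
    have hu : -2 ≤ u ∧ u ≤ 2 := by constructor <;> nlinarith [sq_nonneg (2 * v + u)]
    obtain ⟨hv1, hv2⟩ := hv
    obtain ⟨hu1, hu2⟩ := hu
    interval_cases v <;> interval_cases u <;> omega
  have hq0 : u ^ 2 + u * v + v ^ 2 = 0 → u = 0 ∧ v = 0 := by
    intro h0
    have hv0 : v = 0 := by nlinarith [sq_nonneg (2 * u + v), sq_nonneg v]
    subst hv0
    exact ⟨pow_eq_zero_iff (n := 2) two_ne_zero |>.1 (by linarith), rfl⟩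
  generalize hqdef : u ^ 2 + u * v + v ^ 2 = q at h hq hq2 hq0
  interval_cases b <;> try omega
  all_goals
    obtain ⟨rfl, rfl⟩ := hq0 (by omega)
    rw [Int.gcd_zero_right, Int.gcd_zero_right] at hg
    norm_num at hg

end CMSquare

end SiegelModuli

end Literature.AlgebraicGeometry.ModuliOfAbelianVarieties

end
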